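import Mathlib
import Summits.MatrixMultiplication.MatrixMultiplication.Theses.FidelityWitnesses
import Summits.MatrixMultiplication.MatrixMultiplication.Theorems.FidelityWitnessesFidelityThesisSepMajorantTransfer
import Summits.MatrixMultiplication.MatrixMultiplication.Theorems.FidelityWitnessesFidelityThesisStubTrivialMajorant
import Summits.MatrixMultiplication.MatrixMultiplication.Theorems.FidelityWitnessesFidelityThesisStubProductFrameN
import Summits.MatrixMultiplication.MatrixMultiplication.Theorems.FidelityWitnessesFidelityThesisStubSliceEliminationN
import Summits.MatrixMultiplication.MatrixMultiplication.Theorems.FidelityWitnessesFidelityThesisStubPairCoordinates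
import Summits.MatrixMultiplication.MatrixMultiplication.Theorems.FidelityWitnessesFidelityThesisStubFlipBessel
import Summits.MatrixMultiplication.MatrixMultiplication.Theorems.FidelityWitnessesFidelityThesisStubGramFrobenius
import Summits.MatrixMultiplication.MatrixMultiplication.Theorems.FidelityWitnessesFidelityThesisStubCapBound

/-!
# Line `Sketch` (separable-majorant) for crux `FidelityWitnesses.FidelityThesis` (stmt-MatrixMultiplication-4956) —
n-FREE FIDELITY GROWTH AT THE CRITICAL EXPONENT: `M(n,r) ≤ r^{3/2}` for all `n, r`

**Theorem (`fidelity_le_rpow_threeHalves`).** For every `n`, every `r` and every tensor `S ∈ ℂ^{(n×n)³}` of rank `≤ r`,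

  `|⟨S, ⟨n,n,n⟩⟩|² ≤ r^{3/2} · ‖S‖²`,

i.e. `r` (border) multiplications capture at most `r^{3/2}` of the `n³` units of `n × n` matrix multiplication,
uniformly in `n`.  For `r < n²` this improves the flattening witness `n·r` (`FlatteningWitness`); at `r = n²` both
read `n³` (trivial); the line's open stub `stub_robustnessGrowth` / the node FIDELITY GROWTH(δ′) of
`…SepMajorantTransfer.lean` ask for the same bound with exponent `3/2 − δ′`, which is `≥ ω > 2` in strength
(`…SepMajorantWindow`, evidence) — so this file pins the line's window exactly: exponent `3/2` is a theorem, every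
exponent below it closes the crux.

**Proof** (all finite sums; slots `a = (κ,ν)` out, `b = (κ,μ)`, `c = (μ',ν)`).  Write `S = Σ_{l<r} w_l ⊗ u_l ⊗ v_l`
(`sepMajorant_exists_frame`).  Let `e₁..e_d` be an orthonormal basis of the span `E` of the input products
`u_l ⊗ v_l` (`d ≤ r`, `stub_productFrameN`), and `a₁..a_k`, `b'₁..b'_{k'}` orthonormal families carrying the `u_l`
resp. `v_l` (`k, k' ≤ r`, `sepMajorantTM_orthonormalCoordinates`).  EXACT OUTPUT ELIMINATION
(`stub_sliceEliminationN`): `|⟨S,T⟩|² ≤ ‖S‖² · cap`, `cap = Σ_s Σ_{κν} |Σ_m e_s((κ,m),(m,ν))|² = tr(P_E W_n)`.  Write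
`e_s = Σ_{(i,j)} γ_s(i,j) a_i ⊗ b'_j` with orthonormal rows `γ_s` (`stub_pairCoordinates`).  Then — the one idea —
`cap = tr(P_E W_n) = tr(P_E^{Γ} · FLIP_{μ↔μ'}) = Σ_{q,q'} G_{qq'} M_{qq'}` with `G = Σ_s γ_s γ_s^*` (the projector `P_E`
in the pair family, `‖G‖_F² = d`: `stub_gramFrobenius`) and `M` the matrix of the middle-index flip between the
orthonormal product systems `{a_i ⊗ b̄'_j}` and its twist (`‖M‖_F² ≤ k k'` by Bessel: `stub_flipBessel`), so
Cauchy–Schwarz gives `cap ≤ √d · √(k k') ≤ r^{3/2}` (`stub_capBound`).  (Equivalently: `range(P_E^Γ) ⊂ U ⊗ V̄` has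
dimension `≤ r²` and `‖P_E^Γ‖_F² = d ≤ r`, so `tr(P_E^Γ · FLIP · Π_{U⊗V̄}) ≤ ‖P_E^Γ‖_F ‖FLIP·Π‖_F ≤ √r · r`.)

PRIOR ART (in hub; nothing closer found in print by `lit search`/`lit vsearch` 2026-08-16): the STATEMENT `M(n,r) ≤ r^{3/2}
∀ n r` and the partial-transpose argument (`tr(P_E W_n) = tr(P_E^Γ W_n^Γ)`, `W_n^Γ` a permutation, Hölder, Cauchy–Schwarz on
the singular values of `P_E^Γ`, `rank P_E^Γ ≤ r²`) are the sibling crux's idea card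
`Cruxes/DiagonalPowerDecay/Ideas/realignment-negativity.md` (§ Lever, "proved by hand", `RealignmentBound`; merged into line
`frame-negativity-singlet-fraction`, whose landed files `…DiagonalPowerDecayTwistedCapture/ConverseKeyInequality` develop the
trace-norm side at `r = n²`).  This file is the first KERNEL-CHECKED proof for all `(n, r)`, by an elementary route that never
leaves finite sums: no trace norm, no singular values, no spectral theorem — the Frobenius norm is invariant under the index
scrambling `(i,j'),(i',j) ↔ (i,j),(i',j')`, so Bessel + Cauchy–Schwarz suffice.  For the separable-majorant line it is the
statement "FIDELITY GROWTH holds AT the critical exponent `3/2` with `C = 1`" (node FG of `…SepMajorantTransfer.lean`).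

Supports item `stmt-MatrixMultiplication-4956` (registered assembly `fidelity_le_rpow_threeHalves`); no definitions.
-/

namespace Summit.MatrixMultiplication.MatrixMultiplication.Theorems

open scoped BigOperators ComplexConjugate
open Literature.Computability.AlgebraicComplexity
open Summit.MatrixMultiplication.MatrixMultiplication.Theses.FidelityWitnesses (FidelityThesis)

/-- **n-FREE FIDELITY GROWTH AT THE CRITICAL EXPONENT**: `|⟨S,⟨n,n,n⟩⟩|² ≤ r^{3/2}·‖S‖²` whenever `R(S) ≤ r`, for
every `n` and `r` — `r` (border) multiplications capture at most `r^{3/2}` units of `n × n` matrix multiplication.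
Proof: exact output elimination onto an orthonormal basis of the product span, then
`tr(P_E W_n) = ⟨G, M⟩ ≤ ‖G‖_F‖M‖_F ≤ √d·√(k k') ≤ r^{3/2}` (see the module docstring). -/
theorem fidelity_le_rpow_threeHalves (n r : ℕ) (S : Fin n × Fin n → Fin n × Fin n → Fin n × Fin n → ℂ)
    (hS : tensorRank S ≤ r) :
    ‖∑ a, ∑ b, ∑ c, S a b c * matMulTensor ℂ n n n a b c‖ ^ 2 ≤
      (r : ℝ) ^ ((3 : ℝ) / 2) * ∑ a, ∑ b, ∑ c, ‖S a b c‖ ^ 2 := by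
  -- frame
  obtain ⟨w, u, v, hSwuv⟩ := sepMajorant_exists_frame S hS
  have hSfun : S = fun a b c => ∑ l, w l a * u l b * v l c := by
    funext a b c; exact hSwuv a b c
  -- orthonormal basis of the product span, with coordinates both ways
  obtain ⟨d, e, co, co', hd, he, hco, hco'⟩ := stub_productFrameN u v
  -- orthonormal coordinates of the two legs
  obtain ⟨k, a, α, hk, ha, hu⟩ := sepMajorantTM_orthonormalCoordinates u
  obtain ⟨k', b', β, hk', hb, hv⟩ := sepMajorantTM_orthonormalCoordinates v
  -- coordinates of `e` in the pair family and their orthonormality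
  obtain ⟨γ, hγe, hγ⟩ := stub_pairCoordinates u v e he co' hco' a b' ha hb α β hu hv
  -- the capture bound
  have hcap : ∑ s, ∑ a₀ : Fin n × Fin n, ‖∑ m : Fin n, e s (a₀.1, m) (m, a₀.2)‖ ^ 2 ≤
      Real.sqrt d * Real.sqrt ((k : ℝ) * (k' : ℝ)) :=
    stub_capBound e a b' γ hγe (stub_gramFrobenius γ hγ) (stub_flipBessel a b' ha hb)
  -- slice elimination
  have helim := stub_sliceEliminationN w u v e he co hco
  -- arithmetic: √d √(k k') ≤ r^{3/2}
  set N := ∑ a, ∑ b, ∑ c, ‖∑ l, w l a * u l b * v l c‖ ^ 2 with hN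
  have hNnn : 0 ≤ N := by
    rw [hN]
    exact Finset.sum_nonneg fun a _ => Finset.sum_nonneg fun b _ =>
      Finset.sum_nonneg fun c _ => by positivity
  have hr0 : (0 : ℝ) ≤ r := Nat.cast_nonneg r
  have hdr : (d : ℝ) ≤ r := by exact_mod_cast hd
  have hkr : (k : ℝ) ≤ r := by exact_mod_cast hk
  have hk'r : (k' : ℝ) ≤ r := by exact_mod_cast hk'
  have hsq : Real.sqrt d * Real.sqrt ((k : ℝ) * (k' : ℝ)) ≤ (r : ℝ) ^ ((3 : ℝ) / 2) := by
    have h1 : Real.sqrt d ≤ Real.sqrt r := Real.sqrt_le_sqrt hdr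
    have h2 : Real.sqrt ((k : ℝ) * (k' : ℝ)) ≤ Real.sqrt ((r : ℝ) * r) :=
      Real.sqrt_le_sqrt (mul_le_mul hkr hk'r (Nat.cast_nonneg k') hr0)
    have h3 : Real.sqrt ((r : ℝ) * r) = r := Real.sqrt_mul_self hr0
    have h4 : Real.sqrt (r : ℝ) * r = (r : ℝ) ^ ((3 : ℝ) / 2) := by
      rw [Real.sqrt_eq_rpow, show (3 : ℝ) / 2 = 1 / 2 + 1 by norm_num, Real.rpow_add' hr0 (by norm_num),
        Real.rpow_one]
    calc Real.sqrt d * Real.sqrt ((k : ℝ) * (k' : ℝ)) ≤ Real.sqrt r * Real.sqrt ((r : ℝ) * r) :=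
          mul_le_mul h1 h2 (Real.sqrt_nonneg _) (Real.sqrt_nonneg _)
      _ = Real.sqrt r * r := by rw [h3]
      _ = (r : ℝ) ^ ((3 : ℝ) / 2) := h4
  rw [hSfun]
  calc ‖∑ a, ∑ b, ∑ c, (∑ l, w l a * u l b * v l c) * matMulTensor ℂ n n n a b c‖ ^ 2
      ≤ N * ∑ s, ∑ a₀ : Fin n × Fin n, ‖∑ m : Fin n, e s (a₀.1, m) (m, a₀.2)‖ ^ 2 := helim
    _ ≤ N * (Real.sqrt d * Real.sqrt ((k : ℝ) * (k' : ℝ))) := mul_le_mul_of_nonneg_left hcap hNnn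
    _ ≤ N * (r : ℝ) ^ ((3 : ℝ) / 2) := mul_le_mul_of_nonneg_left hsq hNnn
    _ = (r : ℝ) ^ ((3 : ℝ) / 2) * N := mul_comm _ _

/-- **Capture by `r ≤ n` multiplications**: with `r = n`, `|⟨S,⟨n,n,n⟩⟩|² ≤ n^{3/2}·‖S‖²` — `n` (border)
multiplications capture at most `n^{3/2}` of the `n³` units (the flattening witness gives only `n²`; the partial
standard algorithm shows `≥ n` is attained). -/
theorem fidelity_rank_n_le (n : ℕ) (S : Fin n × Fin n → Fin n × Fin n → Fin n × Fin n → ℂ)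
    (hS : tensorRank S ≤ n) :
    ‖∑ a, ∑ b, ∑ c, S a b c * matMulTensor ℂ n n n a b c‖ ^ 2 ≤
      (n : ℝ) ^ ((3 : ℝ) / 2) * ∑ a, ∑ b, ∑ c, ‖S a b c‖ ^ 2 :=
  fidelity_le_rpow_threeHalves n n S hS

end Summit.MatrixMultiplication.MatrixMultiplication.Theorems
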